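import Summits.AnomalousDissipation.AnomalousDissipation.Theorems.WindLineWindyGalerkinSteadyZerothLawNondegenerateLoudOpenPersist
import Summits.AnomalousDissipation.AnomalousDissipation.Theorems.WindLineWindyGalerkinSteadyZerothLawForceDictionary

/-!
# Stub `stub_nondegenerateLoudOpen` of crux `WindLine.WindyGalerkinSteadyZerothLaw`
# (stmt-AnomalousDissipation-11414), line `registered`

At fixed `ν > 0`, momentum `m` and strict budgets `E`, `ε`, the admissible parameters `c ∈ 𝒜`
whose force `F⟦c⟧` (Fourier coefficients `e^{−|k|²} c k`) carries a leaf-NONDEGENERATE classical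
steady state `u` of `NS_ν(F⟦c⟧)` with `∫ u = m`, `∫|u|² < E`, `ε < ν‖∇u‖²` form an OPEN subset of
`𝒜`: around such a `c₀` (state `u₀`), the steady implicit-function theorem in the leaf with
nondegeneracy of the persisted state (`loudOpen_steadyPersistsNondeg`, for forces measured by
the `ℓ²` distance of their Fourier families — here `∑‖e^{−|k|²}(c k − c₀ k)‖² ≤ ‖c − c₀‖²`) gives,
for `c` in a ball, a nondegenerate steady state of the same momentum `H¹`-close to `u₀`, and the
strict budgets persist (`loudOpen_budgetRadius`).  The force dictionary of `𝒜` (smooth, divergence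
free, mean zero, Fourier coefficients `e^{−|k|²} c k`) is the landed `stub_forceDictionary` /
`forceDict_mFourierCoeff`.
-/

noncomputable section

-- D-0017: single-problem summit ⇒ the duplicated namespace segment is by design.
set_option linter.dupNamespace false

open scoped InnerProductSpace Topology ComplexConjugate
open MeasureTheory Filter UnitAddTorus Set
open Literature.Analysis.FunctionSpaces Literature.Analysis.FunctionSpaces.Torus
open Literature.Analysis.FunctionSpaces.EuclideanSpace
open Literature.Analysis.FluidPDE Literature.Analysis.FluidPDE.Torus

namespace Summit.AnomalousDissipation.AnomalousDissipation.Theorems.WindLineWindyGalerkinSteadyZerothLaw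

/-- The flat three-torus (local notation). -/
local notation "𝕋³" => UnitAddTorus (Fin 3)
/-- Velocity values (local notation). -/
local notation "E³" => EuclideanSpace ℝ (Fin 3)
set_option quotPrecheck false in
/-- admissible parameters -/
local notation "𝒜" => ({c : SymL2 (Fin 3) | c 0 = 0 ∧
  ∀ k : Fin 3 → ℤ, ∑ j : Fin 3, ((k j : ℤ) : ℂ) * c k j = 0} : Set (SymL2 (Fin 3)))
/-- the force of a parameter -/
local notation "F⟦" c "⟧" => SymL2.field (fun k : Fin 3 → ℤ => Real.exp (freqNormSq k)) (c : SymL2 (Fin 3))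

/-! ## §1 The force map is `1`-Lipschitz into the `ℓ²` distance of Fourier families -/

/-- `∑‖e^{−|k|²}(c k − c₀ k)‖² ≤ ‖c − c₀‖²` (the Fourier coefficients of `F⟦c⟧` are `e^{−|k|²} c k`,
`forceDict_mFourierCoeff`, and `e^{−|k|²} ≤ 1`). -/
private theorem tsum_norm_sq_smul_sub_le (c c₀ : SymL2 (Fin 3)) :
    ∑' k, ‖((Real.exp (freqNormSq k) : ℂ))⁻¹ • c k - ((Real.exp (freqNormSq k) : ℂ))⁻¹ • c₀ k‖ ^ 2 ≤
      ‖c - c₀‖ ^ 2 := by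
  have h := SymL2.hasSum_norm_sq (c - c₀)
  have hle : ∀ k, ‖((Real.exp (freqNormSq k) : ℂ))⁻¹ • c k - ((Real.exp (freqNormSq k) : ℂ))⁻¹ • c₀ k‖ ^ 2 ≤
      ‖(c - c₀) k‖ ^ 2 := fun k => by
    rw [← smul_sub, ← SymL2.sub_apply, norm_smul, norm_inv, Complex.norm_real,
      Real.norm_of_nonneg (Real.exp_pos _).le]
    have hw1 : (Real.exp (freqNormSq k))⁻¹ ≤ 1 :=
      inv_le_one_of_one_le₀ (Real.one_le_exp (freqNormSq_nonneg k))
    exact pow_le_pow_left₀ (by positivity) (mul_le_of_le_one_left (norm_nonneg _) hw1) 2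
  have hsum : Summable fun k =>
      ‖((Real.exp (freqNormSq k) : ℂ))⁻¹ • c k - ((Real.exp (freqNormSq k) : ℂ))⁻¹ • c₀ k‖ ^ 2 :=
    Summable.of_nonneg_of_le (fun k => sq_nonneg _) hle h.summable
  calc _ ≤ ∑' k, ‖(c - c₀) k‖ ^ 2 := hsum.tsum_le_tsum hle h.summable
    _ = ‖c - c₀‖ ^ 2 := h.tsum_eq

/-! ## §2 The registered stub -/

/-- **Stub O — nondegenerate loud steady states persist: the good parameters form an OPEN set.**
At fixed `ν > 0`, momentum `m` and strict budgets, the set of admissible parameters whose force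
carries a leaf-nondegenerate classical steady state of momentum `m` with `∫|u|² < E`,
`ε < ν‖∇u‖²` is open in `𝒜`: for `c₀` in the set with state `u₀`, the steady implicit-function
theorem in the conserved-momentum leaf with nondegeneracy of the persisted state
(`loudOpen_steadyPersistsNondeg`) applies to the forces `F⟦c⟧`, `‖c − c₀‖ < r`
(`tsum_norm_sq_smul_sub_le`, `forceDict_mFourierCoeff`), and the strict budgets pass to the
`H¹`-close persisted state (`loudOpen_budgetRadius`). -/
theorem stub_nondegenerateLoudOpen :
    ∀ (ν : ℝ) (m : E³) (E ε : ℝ), 0 < ν →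
      IsOpen {c : 𝒜 | ∃ (u : 𝕋³ → E³) (p : 𝕋³ → ℝ),
        IsSteadyNSState ν F⟦c⟧ u p ∧ ∫ x, u x = m ∧ ¬ IsLinNSEigenvalue ν u 0 ∧
          ∫ x, ‖u x‖ ^ 2 < E ∧ ε < ν * gradNormSq u} := by
  intro ν m E ε hν
  rw [Metric.isOpen_iff]
  rintro c₀ ⟨u₀, p₀, hst, hm, hnd, hE, hε⟩
  have hu₀ : IsSmooth u₀ := hst.smooth_velocity.isSmooth_slice (Set.mem_univ 0)
  obtain ⟨hs₀, hd₀, hm₀⟩ := stub_forceDictionary c₀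
  obtain ⟨δ, hδ, hbud⟩ := loudOpen_budgetRadius u₀ ν E ε hu₀ hE hε
  obtain ⟨r, hr, hper⟩ := loudOpen_steadyPersistsNondeg ν F⟦c₀⟧ u₀ p₀ hν hs₀ hd₀ hm₀ hst hnd δ hδ
  refine ⟨r, hr, fun c hc => ?_⟩
  rw [Metric.mem_ball, Subtype.dist_eq, dist_eq_norm] at hc
  obtain ⟨hs, hd, hmz⟩ := stub_forceDictionary c
  have hff : (∑' k, ‖mFourierCoeff (complexify ∘ F⟦c⟧) k - mFourierCoeff (complexify ∘ F⟦c₀⟧) k‖ ^ 2) < r ^ 2 := by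
    simp only [forceDict_mFourierCoeff]
    exact (tsum_norm_sq_smul_sub_le _ _).trans_lt (pow_lt_pow_left₀ hc (norm_nonneg _) two_ne_zero)
  obtain ⟨u', p', hst', hmean, hnd', hclose⟩ := hper F⟦c⟧ hs hd hmz hff
  obtain ⟨hE', hε'⟩ := hbud u' (hst'.smooth_velocity.isSmooth_slice (Set.mem_univ 0)) hclose
  exact ⟨u', p', hst', hmean.trans hm, hnd', hE', hε'⟩

end Summit.AnomalousDissipation.AnomalousDissipation.Theorems.WindLineWindyGalerkinSteadyZerothLaw

end
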